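import Mathlib
import Literature.NumberTheory.LFunctions.Zhang2022.Section15CU1Bound
import Literature.NumberTheory.LFunctions.Zhang2022.Section15CCalM1FactorLowerBound
import HarnessLib

/-!
# Zhang (2022), Lemma 15.3 (repaired normaliser): the per-prime hypothesis `hloc` —
# holomorphy of `𝔲ᴿ₁ⱼ(q,·)` on `σ > 17/20` and `𝔲ᴿ₁ⱼ(q,s) = 1 + O(q^{−2σ} + q^{−1−σ})` — kernel-checked

Topic `Literature/NumberTheory/LFunctions/Zhang2022` (Landau–Siegel audit tree; verdict-neutral).
Y. Zhang, *Discrete mean estimates and the Landau–Siegel zero*, arXiv:2211.02515v1 (2022)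
[Zhang2022LandauSiegel] — **an unrefereed manuscript under adjudication; nothing in this file asserts
or denies its Theorems 1–2.** ZHANG-L discharge lane (WP15, helper of the leaf owner of
`Typed.Section15C.Lemma153RpI`, rows G-L4t3-1 / G-d52-1 / D-G-d52-1). This file discharges the
hypothesis `hloc` — stated VERBATIM as in the tree's glue theorems `lemma153RpI_of_local`,
`step15_u053R_of_local`, `calU1R_near_one_of_local` — for the repaired Euler factor
`𝔲ᴿ₁ⱼ = Typed.AppendixA2.frakU1FactorR` (App. A p. 105, tex L5176: "`𝔲₁ⱼ(q,s)` … analytic for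
`σ > 9/10` … `= 1 + O(q^{−2σ})` if `(q,D) = 1`", in the reading of row D-G-d52-1 with the genuine
first-order term `q^{−1−σ}`):

* **holomorphy**: for EVERY prime `q`, `s ↦ 𝔲ᴿ₁ⱼ(q,s)` is holomorphic on `{Re s > 17/20}` — it is a
  polynomial in `q^{−s}` there: the closed form `Lemma153Rp.frakU1FactorR_eq_poly` when `χ(q) = ±1`
  and `(1 − q^{−s})²` when `χ(q) = 0` (`Lemma153Rp.frakU1FactorR_eq_of_chi_eq_zero`; `χ` is real, so
  these are all cases);
* **the factor bound** for `q ∤ D`: `‖𝔲ᴿ₁ⱼ(q,s) − 1‖ ≤ C(q^{−2σ} + q^{−(1+σ)})` on `σ > 17/20`, from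
  `Lemma153Rp.norm_frakU1FactorR_sub_one_le` (`≤ |x|² + (M/q)(24|x| + 8|x|²)`, `x = q^{−s}`) with the
  UNIFORM `M`: `‖F_q(1,1;1−βⱼ)‖ ≥ c₀` for every prime (`norm_calM1Factor_one_one_betaJ_ge`), the
  convergence of the Euler product of `𝓜₁(1,1;1−βⱼ)` and `‖𝓜₁(1,1;1−βⱼ)‖ ≥ 1/2`
  (`Lemma153Rp.eq15_18_at_betaJ`), `ϖ₁ⱼ(1) = 1` (`Lemma153Rp.inline15_varpiMult_holds`).

PROVED: `hloc_holds` (theorems only; no new definitions; no new named facts).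

## References

* Y. Zhang, arXiv:2211.02515v1 (2022), App. A p. 105 (tex L5170–L5178); §15 Lemma 15.3 p. 87,
  (15.18) p. 85. [cite: Zhang2022LandauSiegel, App. A p. 105; §15 Lemma 15.3 p. 87]
-/

noncomputable section

open Complex Real Filter Topology

namespace Literature.NumberTheory.LFunctions.Zhang2022.Typed.Section15C

open Literature.NumberTheory.LFunctions.Zhang2022
open Literature.NumberTheory.LFunctions.Zhang2022.Skeleton
open Literature.NumberTheory.LFunctions.Zhang2022.Typed.Section15A
open Literature.NumberTheory.LFunctions.Zhang2022.Typed.Section15B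
open Literature.NumberTheory.LFunctions.Zhang2022.Typed.AppendixA2

/-- `s ↦ q^{−s}` is entire (`q ≥ 1`). [folklore] -/
private theorem differentiable_natCast_cpow_neg {q : ℕ} (hq : 0 < q) :
    Differentiable ℂ fun s : ℂ => (q : ℂ) ^ (-s) := by
  have hq0 : (q : ℂ) ≠ 0 := by exact_mod_cast hq.ne'
  exact differentiable_id.neg.const_cpow (Or.inl hq0)

/-- **`hloc` HOLDS** — the per-prime hypothesis of `lemma153RpI_of_local` / `step15_u053R_of_local` /
`calU1R_near_one_of_local`, VERBATIM: for all large `D`, under (A), for `1 ≤ j ≤ 3` and every prime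
`q`, `s ↦ 𝔲ᴿ₁ⱼ(q,s)` is holomorphic on `{Re s > 17/20}`, and for `q ∤ D`,
`‖𝔲ᴿ₁ⱼ(q,s) − 1‖ ≤ C·(q^{−2σ} + q^{−(1+σ)})` there. Holomorphy: on `Re s > 0` the factor is a
polynomial in `q^{−s}` (`frakU1FactorR_eq_poly` for `χ(q) = ±1`, `(1 − q^{−s})²` for `χ(q) = 0`).
Bound: `norm_frakU1FactorR_sub_one_le` with `‖F_q(1,1;1−βⱼ)‖⁻¹ ≤ c₀⁻¹` uniformly in `q`
(`norm_calM1Factor_one_one_betaJ_ge`), `|x| = q^{−σ} ≤ 1`, so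
`|x|² + (M/q)(24|x| + 8|x|²) ≤ q^{−2σ} + 32M·q^{−1−σ}`; `C = max(1, 32M)`,
`M = c₀⁻¹(90Z₂ + 72 + 45W²)`. [cite: Zhang2022LandauSiegel, App. A p. 105; §15 Lemma 15.3 p. 87] -/
theorem hloc_holds (c' : ℝ) : ∃ C : ℝ, ForAllLarge fun D _ χ => AssumptionA D χ →
    ∀ j ∈ ({1, 2, 3} : Finset ℕ), ∀ q : ℕ, q.Prime →
      DifferentiableOn ℂ (fun s => frakU1FactorR c' χ j q s) {s : ℂ | 17 / 20 < s.re} ∧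
        (¬ q ∣ D → ∀ s : ℂ, 17 / 20 < s.re →
          ‖frakU1FactorR c' χ j q s - 1‖ ≤
            C * ((q : ℝ) ^ (-(2 * s.re)) + (q : ℝ) ^ (-(1 + s.re)))) := by
  classical
  obtain ⟨c₀, hc₀, hF⟩ := Typed.Section15B.norm_calM1Factor_one_one_betaJ_ge c'
  -- the uniform constant
  have hZ₂0 : 0 ≤ ∑' m : ℕ, ((m : ℝ) + 1) ^ 2 * (1 / 2 : ℝ) ^ m := tsum_nonneg fun m => by positivity
  have hM0 : 0 ≤ 2 * (1 / (2 * c₀)) * (90 * (∑' m : ℕ, ((m : ℝ) + 1) ^ 2 * (1 / 2 : ℝ) ^ m) + 72 +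
      45 * (∑' m : ℕ, ((m : ℝ) + 2) ^ 2 * (1 / 2 : ℝ) ^ m) ^ 2) := by positivity
  refine ⟨max 1 (32 * (2 * (1 / (2 * c₀)) * (90 * (∑' m : ℕ, ((m : ℝ) + 1) ^ 2 * (1 / 2 : ℝ) ^ m) +
      72 + 45 * (∑' m : ℕ, ((m : ℝ) + 2) ^ 2 * (1 / 2 : ℝ) ^ m) ^ 2))),
    ((hF.and (Lemma153Rp.eq15_18_at_betaJ c')).and (Lemma153Rp.inline15_varpiMult_holds c')).mono
      fun D _ χ hquad _ h hA j hj q hq => ?_⟩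
  obtain ⟨⟨hFD, h18⟩, hmult⟩ := h
  obtain ⟨hhalf, hmul, -⟩ := h18 hA j
  have hne : calM1 c' χ 1 1 (1 - betaJ c' D j) ≠ 0 := by
    intro h0; rw [h0, norm_zero] at hhalf; norm_num at hhalf
  have hv1 : varpi1 c' χ j 1 = 1 := (hmult hA j hj).1
  have hq0 : 0 < q := hq.pos
  have hX := differentiable_natCast_cpow_neg hq0
  -- `χ` is real: `χ(q) ∈ {0, 1, −1}`
  have hcases : χ (q : ZMod D) = 0 ∨ χ (q : ZMod D) ^ 2 = 1 := by
    rcases hquad (q : ZMod D) with h0 | h1 | h1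
    · exact Or.inl h0
    · exact Or.inr (by rw [h1]; norm_num)
    · exact Or.inr (by rw [h1]; norm_num)
  refine ⟨?_, fun hnd s hs => ?_⟩
  · -- holomorphy: a polynomial in `q^{−s}` on `Re s > 0 ⊇ {Re s > 17/20}`
    rcases hcases with h0 | hv
    · have hEq : ∀ s : ℂ, frakU1FactorR c' χ j q s = (1 - (q : ℂ) ^ (-s)) ^ 2 :=
        fun s => Lemma153Rp.frakU1FactorR_eq_of_chi_eq_zero c' χ h0 j hv1 s
      have hd : Differentiable ℂ fun s : ℂ => (1 - (q : ℂ) ^ (-s)) ^ 2 :=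
        ((differentiable_const 1).sub hX).pow 2
      exact hd.differentiableOn.congr fun s _ => hEq s
    · -- the closed form is `Φ(q^{−s})` for the polynomial `Φ` below
      have hΦ : Differentiable ℂ fun x : ℂ =>
          (1 - x) ^ 2 * (1 - χ (q : ZMod D) * (q : ℂ) ^ betaJ c' D j * x) ^ 2 +
            calM1Factor c' χ q 1 q (1 - betaJ c' D j) / calM1Factor c' χ q 1 1 (1 - betaJ c' D j) *
              ((1 - χ (q : ZMod D) * (q : ℂ) ^ betaJ c' D j * x) ^ 2 * (2 * x - x ^ 2)) +
            lam1 c' χ q 1 * calM1Factor c' χ q q 1 (1 - betaJ c' D j) /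
                calM1Factor c' χ q 1 1 (1 - betaJ c' D j) *
              ((1 - x) ^ 2 * (2 * (χ (q : ZMod D) * (q : ℂ) ^ betaJ c' D j * x) -
                (χ (q : ZMod D) * (q : ℂ) ^ betaJ c' D j * x) ^ 2)) +
            lam1 c' χ q 1 * calM1Factor c' χ q q q (1 - betaJ c' D j) /
                calM1Factor c' χ q 1 1 (1 - betaJ c' D j) *
              ((χ (q : ZMod D) * (q : ℂ) ^ betaJ c' D j * x) * x *
                (3 - 2 * x - 2 * (χ (q : ZMod D) * (q : ℂ) ^ betaJ c' D j * x) +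
                  (χ (q : ZMod D) * (q : ℂ) ^ betaJ c' D j * x) * x)) := by
        fun_prop
      refine (hΦ.comp hX).differentiableOn.congr fun s hs => ?_
      have hs0 : 0 < s.re := by simp only [Set.mem_setOf_eq] at hs; linarith
      rw [Lemma153Rp.frakU1FactorR_eq_poly c' χ hq hv j hmul hne hs0]
      simp only [Function.comp]
  · -- the factor bound for `q ∤ D`
    have hs0 : 0 < s.re := by linarith
    have hcop : Nat.Coprime q D := (Nat.Prime.coprime_iff_not_dvd hq).mpr hnd
    have hχ0 : χ (q : ZMod D) ≠ 0 := by
      have hu : χ (q : ZMod D) = ((χ.toUnitHom (ZMod.unitOfCoprime q hcop) : ℂˣ) : ℂ) := by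
        rw [MulChar.coe_toUnitHom, ZMod.coe_unitOfCoprime]
      rw [hu]; exact Units.ne_zero _
    have hv : χ (q : ZMod D) ^ 2 = 1 := hcases.resolve_left hχ0
    have hKq : ‖calM1Factor c' χ q 1 1 (1 - betaJ c' D j)‖⁻¹ ≤ 2 * (1 / (2 * c₀)) := by
      have hge : c₀ ≤ ‖calM1Factor c' χ q 1 1 (1 - betaJ c' D j)‖ := hFD hA j hj q hq
      calc ‖calM1Factor c' χ q 1 1 (1 - betaJ c' D j)‖⁻¹ ≤ c₀⁻¹ := inv_anti₀ hc₀ hge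
        _ = 2 * (1 / (2 * c₀)) := by field_simp
    have hB := Lemma153Rp.norm_frakU1FactorR_sub_one_le c' χ hq hv j hmul hne hKq hs0
    set Z₂ : ℝ := ∑' m : ℕ, ((m : ℝ) + 1) ^ 2 * (1 / 2 : ℝ) ^ m with hZ₂
    set W : ℝ := ∑' m : ℕ, ((m : ℝ) + 2) ^ 2 * (1 / 2 : ℝ) ^ m with hW
    set M : ℝ := 2 * (1 / (2 * c₀)) * (90 * Z₂ + 72 + 45 * W ^ 2) with hM
    -- `|x| = q^{−σ} ≤ 1`
    have hqpos : (0 : ℝ) < q := by exact_mod_cast hq0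
    have hq1 : (1 : ℝ) ≤ q := by exact_mod_cast hq.one_lt.le
    have hxn : ‖(q : ℂ) ^ (-s)‖ = (q : ℝ) ^ (-s.re) := by
      rw [Complex.norm_natCast_cpow_of_pos hq0, Complex.neg_re]
    have hx1 : (q : ℝ) ^ (-s.re) ≤ 1 := Real.rpow_le_one_of_one_le_of_nonpos hq1 (by linarith)
    have hx0 : 0 ≤ (q : ℝ) ^ (-s.re) := Real.rpow_nonneg hqpos.le _
    have hx2 : ((q : ℝ) ^ (-s.re)) ^ 2 = (q : ℝ) ^ (-(2 * s.re)) := by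
      rw [← Real.rpow_natCast, ← Real.rpow_mul hqpos.le]; congr 1; push_cast; ring
    have hx11 : (q : ℝ)⁻¹ * (q : ℝ) ^ (-s.re) = (q : ℝ) ^ (-(1 + s.re)) := by
      rw [← Real.rpow_neg_one, ← Real.rpow_add hqpos]; congr 1; ring
    rw [hxn] at hB
    refine hB.trans ?_
    have h32 : 24 * (q : ℝ) ^ (-s.re) + 8 * ((q : ℝ) ^ (-s.re)) ^ 2 ≤ 32 * (q : ℝ) ^ (-s.re) := by
      nlinarith
    have hMq : 0 ≤ M / q := by positivity
    calc ((q : ℝ) ^ (-s.re)) ^ 2 + M / q * (24 * (q : ℝ) ^ (-s.re) + 8 * ((q : ℝ) ^ (-s.re)) ^ 2)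
        ≤ ((q : ℝ) ^ (-s.re)) ^ 2 + M / q * (32 * (q : ℝ) ^ (-s.re)) := by gcongr
      _ = 1 * (q : ℝ) ^ (-(2 * s.re)) + 32 * M * ((q : ℝ)⁻¹ * (q : ℝ) ^ (-s.re)) := by
          rw [hx2, div_eq_mul_inv]; ring
      _ = 1 * (q : ℝ) ^ (-(2 * s.re)) + 32 * M * (q : ℝ) ^ (-(1 + s.re)) := by rw [hx11]
      _ ≤ max 1 (32 * M) * (q : ℝ) ^ (-(2 * s.re)) + max 1 (32 * M) * (q : ℝ) ^ (-(1 + s.re)) := by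
          gcongr
          · exact le_max_left _ _
          · exact le_max_right _ _
      _ = max 1 (32 * M) * ((q : ℝ) ^ (-(2 * s.re)) + (q : ℝ) ^ (-(1 + s.re))) := by ring

end Literature.NumberTheory.LFunctions.Zhang2022.Typed.Section15C
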